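import Literature.AlgebraicGeometry.Motives.CrystallineRealization
import Literature.AlgebraicGeometry.Motives.SupportedSheaves
import Literature.Algebra.Homology.ExtCokernelBockstein
import Literature.Algebra.Homology.TorsionFreeLimitFamily
import Mathlib.RingTheory.WittVector.DiscreteValuationRing
import HarnessLib

/-!
# Integers prime to `p` act invertibly on `𝒪_𝒳`-modules over `W(k)` and on their cohomology

For `k` a field of characteristic `p` and `𝒳` a scheme over the Witt vectors `W(k)`
(`SchemeOver (WittVector p k)`), an integer `ℓ` not divisible by `p` is a unit of `W(k)` (its
`0`-th Witt component `ℓ ∈ k` is non-zero; Mathlib `WittVector.isUnit_of_coeff_zero_ne_zero`), hence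
a unit of every ring of sections `Γ(𝒳, U)` (a `W(k)`-algebra through the structure morphism), so
multiplication by `ℓ` is bijective on the sections of every `𝒪_𝒳`-module `M` (`zsmul_sections_bijective`),
`ℓ • 𝟙` is an automorphism of the abelian sheaf underlying `M` (`isIso_zsmul_id_toSheaf`), and
multiplication by `ℓ` is bijective on the cohomology groups `Hⁿ(𝒳, M)` (`zsmul_H_bijective`).
Consequently "no `p`-torsion" is the same as "no torsion at all" for these cohomology groups
(`eq_zero_of_zsmul_eq_zero_of_pTorsionFree`): the hypotheses of crux P1a of route
`PadicSemiregularLift` (`H^b(𝒳, 𝒪)`, `H^b(𝒳, Ω¹)` have no `p`-torsion) give torsion-freeness for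
every non-zero integer, the form in which the rational (`⊗ ℚ`) degeneration of the Hodge–de Rham
spectral sequence and the clearing of denominators of a rational pro-class are consumed.

[folklore] Everything is proved; no named facts. NOT here: the `W(k)`-module structure on cohomology.
-/

namespace Literature.AlgebraicGeometry.Motives.WittScheme

open CategoryTheory _root_.AlgebraicGeometry Opposite TopologicalSpace
open Literature.AlgebraicGeometry.Motives

universe u

section Units

variable (p : ℕ) [Fact p.Prime] (k : Type u) [Field k] [CharP k p]

/-- An integer prime to `p` is a unit of `W(k)` (`k` a field of characteristic `p`): its `0`-th Witt
component is `ℓ ≠ 0` in `k`. [folklore] -/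
theorem isUnit_intCast_wittVector {ℓ : ℤ} (hℓ : ¬ (p : ℤ) ∣ ℓ) : IsUnit ((ℓ : ℤ) : WittVector p k) := by
  refine WittVector.isUnit_of_coeff_zero_ne_zero _ ?_
  rw [← WittVector.constantCoeff_apply, map_intCast]
  exact fun h => hℓ ((CharP.intCast_eq_zero_iff k p ℓ).mp h)

variable {p k}

/-- On a `W(k)`-scheme `𝒳`, an integer prime to `p` is a unit of every ring of sections `Γ(𝒳, U)`
(image of a unit of `W(k)` under `W(k) → Γ(Spec W, ⊤) → Γ(𝒳, ⊤) → Γ(𝒳, U)`). [folklore] -/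
theorem isUnit_intCast_sections (𝒳 : SchemeOver (WittVector p k)) (U : 𝒳.left.Opens) {ℓ : ℤ}
    (hℓ : ¬ (p : ℤ) ∣ ℓ) : IsUnit ((ℓ : ℤ) : Γ(𝒳.left, U)) := by
  let φ : WittVector p k →+* Γ(𝒳.left, U) :=
    (𝒳.left.presheaf.map (homOfLE le_top).op).hom.comp
      (𝒳.hom.appTop.hom.comp (Scheme.ΓSpecIso (CommRingCat.of (WittVector p k))).inv.hom)
  have h := (isUnit_intCast_wittVector p k hℓ).map φ
  rwa [map_intCast] at h

end Units

section Modules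

variable {p : ℕ} [Fact p.Prime] {k : Type u} [Field k] [CharP k p]
  (𝒳 : SchemeOver (WittVector p k)) (M : 𝒳.left.Modules)

/-- **Multiplication by an integer prime to `p` is bijective on the sections of every `𝒪_𝒳`-module**
over a `W(k)`-scheme (the sections over `U` are a `Γ(𝒳, U)`-module and `ℓ` is a unit there).
[folklore] -/
theorem zsmul_sections_bijective (U : 𝒳.left.Opens) {ℓ : ℤ} (hℓ : ¬ (p : ℤ) ∣ ℓ) :
    Function.Bijective fun s : Γ(M, U) => ℓ • s := by
  obtain ⟨u, hu⟩ := isUnit_intCast_sections 𝒳 U hℓ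
  have hs : ∀ s : Γ(M, U), ℓ • s = (u : Γ(𝒳.left, U)) • s := fun s => by
    rw [hu, Int.cast_smul_eq_zsmul]
  refine ⟨fun a b h => ?_, fun t => ⟨(↑u⁻¹ : Γ(𝒳.left, U)) • t, ?_⟩⟩
  · have h' : (u : Γ(𝒳.left, U)) • a = (u : Γ(𝒳.left, U)) • b := by simpa only [hs] using h
    have h'' := congrArg ((↑u⁻¹ : Γ(𝒳.left, U)) • ·) h'
    simpa only [smul_smul, Units.inv_mul, one_smul] using h''
  · simp only [hs, smul_smul, Units.mul_inv, one_smul]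

/-- For an integer `ℓ` prime to `p`, `ℓ • 𝟙` is an automorphism of the abelian sheaf underlying any
`𝒪_𝒳`-module on a `W(k)`-scheme. [folklore] -/
theorem isIso_zsmul_id_toSheaf {ℓ : ℤ} (hℓ : ¬ (p : ℤ) ∣ ℓ) :
    IsIso (ℓ • 𝟙 ((SheafOfModules.toSheaf 𝒳.left.ringCatSheaf).obj M)) :=
  Sheaf.isIso_of_bijective _ fun U => by
    change Function.Bijective fun s : Γ(M, U.unop) => (ℓ • 𝟙 ((SheafOfModules.toSheaf
      𝒳.left.ringCatSheaf).obj M)).hom.app U s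
    have h : (fun s : Γ(M, U.unop) => (ℓ • 𝟙 ((SheafOfModules.toSheaf
        𝒳.left.ringCatSheaf).obj M)).hom.app U s) = fun s => ℓ • s := by
      funext s
      rfl
    rw [h]
    exact zsmul_sections_bijective 𝒳 M U.unop hℓ

/-- **Multiplication by an integer prime to `p` is bijective on `Hⁿ(𝒳, M)`** (`Sheaf.H` of the
abelian sheaf underlying an `𝒪_𝒳`-module `M` on a `W(k)`-scheme): `Hⁿ` of the automorphism `ℓ • 𝟙`
is multiplication by `ℓ`. [folklore] -/
theorem zsmul_H_bijective (n : ℕ) {ℓ : ℤ} (hℓ : ¬ (p : ℤ) ∣ ℓ) :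
    Function.Bijective fun x : ((SheafOfModules.toSheaf 𝒳.left.ringCatSheaf).obj M).H n => ℓ • x := by
  haveI := isIso_zsmul_id_toSheaf 𝒳 M hℓ
  set F := (SheafOfModules.toSheaf 𝒳.left.ringCatSheaf).obj M
  let e := asIso (ℓ • 𝟙 F)
  have hmap : (fun x : F.H n => ℓ • x) = Sheaf.H.map e.hom n := by
    funext x
    exact (Literature.Algebra.Homology.Sheaf.H.map_zsmul_id F ℓ x).symm
  rw [hmap]
  have hinv : ∀ x, Sheaf.H.map e.inv n (Sheaf.H.map e.hom n x) = x := fun x => by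
    rw [← Sheaf.H.map_comp_apply, e.hom_inv_id, Sheaf.H.map_id_apply]
  have hinv' : ∀ x, Sheaf.H.map e.hom n (Sheaf.H.map e.inv n x) = x := fun x => by
    rw [← Sheaf.H.map_comp_apply, e.inv_hom_id, Sheaf.H.map_id_apply]
  exact ⟨Function.LeftInverse.injective hinv, Function.RightInverse.surjective hinv'⟩

/-- **No `p`-torsion ⇒ no torsion** for the cohomology of an `𝒪_𝒳`-module over `W(k)`: if `Hⁿ(𝒳, M)`
has no `p`-torsion then `m • x = 0` with `m ≠ 0` forces `x = 0` (write `m = p^a ℓ` with `p ∤ ℓ`;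
`ℓ` acts bijectively, `p^a` injectively). [folklore] -/
theorem eq_zero_of_zsmul_eq_zero_of_pTorsionFree (n : ℕ)
    (htf : ∀ x : ((SheafOfModules.toSheaf 𝒳.left.ringCatSheaf).obj M).H n, (p : ℤ) • x = 0 → x = 0)
    {m : ℤ} (hm : m ≠ 0) (x : ((SheafOfModules.toSheaf 𝒳.left.ringCatSheaf).obj M).H n)
    (hx : m • x = 0) : x = 0 := by
  obtain ⟨a, ℓ, rfl, hℓ⟩ := Literature.Algebra.Homology.exists_eq_pow_mul_not_dvd (Fact.out : p.Prime) hm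
  rw [mul_smul] at hx
  have hx' : ℓ • x = 0 :=
    Literature.Algebra.Homology.eq_zero_of_pow_zsmul_eq_zero htf a (ℓ • x) hx
  have h0 : ℓ • x = ℓ • (0 : ((SheafOfModules.toSheaf 𝒳.left.ringCatSheaf).obj M).H n) := by
    rw [hx', smul_zero]
  exact (zsmul_H_bijective 𝒳 M n hℓ).1 h0

end Modules

end Literature.AlgebraicGeometry.Motives.WittScheme
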